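import Summits.BirchSwinnertonDyer.Rank1Residual.Additive.ChiBranchRatLowerDvdOdd
import Summits.BirchSwinnertonDyer.Rank1Residual.Additive.ChiBranchRatLowerDvdMultOdd
import Summits.BirchSwinnertonDyer.Rank1Residual.Additive.TameBranchExtraZerosLaw
import Summits.BirchSwinnertonDyer.Rank1Residual.Additive.ChiBranchLowerTransportPotMult
import Summits.BirchSwinnertonDyer.Rank1Residual.Additive.TypeGThree
import Summits.BirchSwinnertonDyer.Rank1Residual.Additive.GordThreeCycLowerCore
import Summits.BirchSwinnertonDyer.Rank1Residual.Additive.CycLeadingTermDvdIff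
import Summits.BirchSwinnertonDyer.Rank1Residual.AdditivePotMult.RankZeroChiBranchThreeFacts
import HarnessLib

/-!
# U3 / ROUTE-IW, prover task P3: the IMAGE-FREE, KATO-FREE lower end — a Λ-algebra lemma
# (one-sided rational containment + ONE unit coefficient ⟹ integral divisibility at `T = 0`) and its
# consequence H★ + H7 ⟹ the `T = 0` branch input / A0 WITHOUT Kato's half and WITHOUT `surj(3)`
# (cell `bsd-uniform`, seat u3-p1; `u3/ROUTE-IW.md` §8 P3; self-contained)

HONEST FRAMING (cell `bsd-uniform`, run/shared/lean/pub/bsd-uniform/, verbatim in every file): the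
goal of the cell is a CONDUCTOR-FREE BSD formula in analytic rank `≤ 1` via UNIFORM CLASS THEOREMS
whose hypotheses are class predicates and PRINTED theorems, replacing per-curve certificates. THIS
FILE proves NO statement about `L`-values or Selmer groups beyond bookkeeping: §1 is PURE Λ-ALGEBRA
(`Λ = ℤ_p⟦T⟧`, any prime `p`) — if `p^m · g ∈ (G)` in `Λ` and `ι G = p^n · G₀` with `G₀ ∈ ℚ_p⟦T⟧`
having SOME coefficient of norm `1`, then `g(0) = c · G₀(0)` with `c ∈ ℤ_p` (proof: Gauss's lemma
`μ(hG) = μ(h) + μ(G)` in `Λ`, `μ(G) ≤ n` from the unit coefficient, `μ(h) ≤ v_p(h(0))`); §2 applies it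
to the route's boxed H★ (`ChiBranchRatLowerDvdOddAt` / `ChiBranchRatLowerDvdMultOddAt`, `@[conjecture]`,
NOT in print) and H7 (one unit coefficient; per pair a finite computation, uniformly Greenberg's
`μ = 0` — kept as a binder) to obtain the INTEGRAL `T = 0` branch input `ChiBranchLowerLeadingTermOddAt`
and hence A0 = `CycLowerLeadingTermAt W 3` with NO Kato input and NO image hypothesis — so the
conditional uniform LOWER half of the sibling files holds in the image-free shape of `N10.LowerHalf`
at `3` (also on the irreducible NON-surjective rows, census pocket O8, for the LOWER half). Nothing is
booked; no density moves; no summit claim.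

WHY THIS IS NOVEL (one sentence): the tree's ends from the rational branch statements all pass through
the rational EQUALITY (Kato's half + tower surjectivity) before using the unit coefficient
(`X9.exponent_nonneg_of_exists_norm_coeff_eq_one`); the Λ-lemma below shows the ONE-SIDED containment
already suffices at `T = 0`, which removes Kato and `surj(3)` from the LOWER half — the route's only
new lemma (ROUTE-IW §8 P3, §9 (iv)).

Sources: L. Washington, GTM 83, §7.1 (Λ/pΛ = 𝔽_p⟦T⟧ a domain; `μ`, distinguished polynomials) —
tree `X1/MuLambdaAlgebra.lean` (`mu`, `mu_mul`), `Additive/TameBranchExtraZerosLaw.lean`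
(`mu_le_valuation_constantCoeff`); Mazur–Tate–Teitelbaum 1986 §I.13–I.14 (constant terms of the
branches: tree `constantCoeff_padicLFunctionMinusBranch_half`, `…MinusBranchMult_half`). Theorems only.
-/

noncomputable section

open scoped Classical NumberField MatrixGroups ModularForm

open CongruenceSubgroup WeierstrassCurve NumberField IsDedekindDomain
  Literature.NumberTheory.EllipticCurves
  Literature.NumberTheory.EllipticCurves.ModularForms
  Literature.NumberTheory.EllipticCurves.Rank1Residual
  Literature.NumberTheory.EllipticCurves.Rank1Residual.Typed
  Summit.BirchSwinnertonDyer.Rank1Residual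
  Summit.BirchSwinnertonDyer.Rank1Residual.Additive
  Summit.BirchSwinnertonDyer.Rank1Residual.X1.MuLambda

namespace Summit.BirchSwinnertonDyer.Uniform.U3

/-! ### §1 The Λ-lemma: one-sided rational containment + a unit coefficient ⟹ `G₀(0) ∣ g(0)` in `ℤ_p` -/

section LambdaAlgebra

variable {p : ℕ} [hp : Fact p.Prime]

/-- `μ(G) ≤ n` when `ι G = p^n · G₀` and some coefficient of `G₀` has norm `≥ 1` (valuation `≤ 0`):
that coefficient of `G` has valuation `≤ n`, and `p^{μ(G)}` divides it. [cite: Washington1997, §7.1] -/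
theorem mu_le_of_iota_eq_C_pow_mul_of_one_le_norm_coeff {G : IwasawaAlgebra p} (hG : G ≠ 0) {n : ℕ}
    {G₀ : PowerSeries ℚ_[p]} (hιG : iwasawaToPowerSeries p G = PowerSeries.C ((p : ℚ_[p]) ^ n) * G₀)
    (hunit : ∃ k : ℕ, 1 ≤ ‖PowerSeries.coeff k G₀‖) : mu G ≤ n := by
  obtain ⟨k, hk⟩ := hunit
  have hpQ : (p : ℚ_[p]) ≠ 0 := Nat.cast_ne_zero.mpr hp.out.ne_zero
  -- the `k`-th coefficient of `G` is `p^n · [T^k]G₀`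
  have hcoef : ((PowerSeries.coeff k G : ℤ_[p]) : ℚ_[p]) = (p : ℚ_[p]) ^ n * PowerSeries.coeff k G₀ := by
    rw [← Wuthrich2014.coeff_iwasawaToPowerSeries p G k, hιG, PowerSeries.coeff_C_mul]
  have hG₀k : PowerSeries.coeff k G₀ ≠ 0 := norm_pos_iff.mp (lt_of_lt_of_le one_pos hk)
  have hck : (PowerSeries.coeff k G : ℤ_[p]) ≠ 0 := by
    intro h0
    have : ((PowerSeries.coeff k G : ℤ_[p]) : ℚ_[p]) = 0 := by rw [h0, PadicInt.coe_zero]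
    rw [hcoef] at this
    exact (mul_ne_zero (pow_ne_zero _ hpQ) hG₀k) this
  -- its valuation is `≤ n`
  have hval : (((PowerSeries.coeff k G : ℤ_[p]) : ℚ_[p])).valuation ≤ n := by
    have hv0 : (PowerSeries.coeff k G₀).valuation ≤ 0 := by
      have h := Padic.norm_eq_zpow_neg_valuation hG₀k
      have h1p : (1 : ℝ) < p := by exact_mod_cast hp.out.one_lt
      have hk' : (p : ℝ) ^ (0 : ℤ) ≤ (p : ℝ) ^ (-(PowerSeries.coeff k G₀).valuation) := by
        rw [zpow_zero, ← h]; exact hk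
      have := (zpow_le_zpow_iff_right₀ h1p).mp hk'
      omega
    rw [hcoef, Padic.valuation_mul (pow_ne_zero _ hpQ) hG₀k, Padic.valuation_pow, Padic.valuation_p,
      mul_one]
    omega
  -- `p^{μ(G)}` divides it
  have hdvd : ((p : ℤ_[p]) ^ mu G) ∣ PowerSeries.coeff k G :=
    (Literature.NumberTheory.EllipticCurves.PowerSeries.C_dvd_iff_forall_dvd_coeff _ G).mp
      (C_pow_mu_dvd hG) k
  have hle : mu G ≤ (PowerSeries.coeff k G).valuation :=
    (PadicInt.mem_span_pow_iff_le_valuation _ hck (mu G)).mp (Ideal.mem_span_singleton.mpr hdvd)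
  have hnat : ((PowerSeries.coeff k G).valuation : ℤ) ≤ n := by
    rw [← PadicInt.valuation_coe]; exact hval
  omega

/-- **The Λ-lemma (ROUTE-IW §8 P3).** Let `g, G ∈ Λ = ℤ_p⟦T⟧`, `m, n ∈ ℕ`, `G₀ ∈ ℚ_p⟦T⟧` with
`p^m · g ∈ (G)`, `ι G = p^n · G₀`, and SOME coefficient of `G₀` of norm `1` (`μ(G₀) ≤ 0`). Then
`g(0) = c · G₀(0)` for some `c ∈ ℤ_p`. Proof: `p^m g = h G`; if `g(0) = 0` take `c = 0`; else
`h, G ≠ 0`, `μ(h) + μ(G) = m + μ(g)` (Gauss's lemma in `Λ`), `μ(G) ≤ n`, `μ(h) ≤ v_p(h(0))`, so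
`v_p(g(0)) = v_p(h(0)) + n + v_p(G₀(0)) − m ≥ μ(g) − μ(G) + n + v_p(G₀(0)) ≥ v_p(G₀(0))`.
[cite: Washington1997, §7.1] -/
theorem exists_padicInt_constantCoeff_eq_mul_of_C_pow_mul_mem_span_of_one_le {g G : IwasawaAlgebra p}
    {m n : ℕ} {G₀ : PowerSeries ℚ_[p]} (hmem : PowerSeries.C ((p : ℤ_[p]) ^ m) * g ∈ Ideal.span {G})
    (hιG : iwasawaToPowerSeries p G = PowerSeries.C ((p : ℚ_[p]) ^ n) * G₀)
    (hunit : ∃ k : ℕ, 1 ≤ ‖PowerSeries.coeff k G₀‖) :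
    ∃ c : ℤ_[p], ((PowerSeries.constantCoeff g : ℤ_[p]) : ℚ_[p]) =
      (c : ℚ_[p]) * PowerSeries.constantCoeff G₀ := by
  have hpQ : (p : ℚ_[p]) ≠ 0 := Nat.cast_ne_zero.mpr hp.out.ne_zero
  obtain ⟨h, hh⟩ := Ideal.mem_span_singleton'.mp hmem
  -- constant coefficients: `h(0) · p^n · G₀(0) = p^m · g(0)` in `ℚ_p`
  have hG0 : ((PowerSeries.constantCoeff G : ℤ_[p]) : ℚ_[p]) =
      (p : ℚ_[p]) ^ n * PowerSeries.constantCoeff G₀ := by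
    rw [← constantCoeff_iwasawaToPowerSeries, hιG, map_mul, PowerSeries.constantCoeff_C]
  have h0 : ((PowerSeries.constantCoeff h : ℤ_[p]) : ℚ_[p]) *
      ((p : ℚ_[p]) ^ n * PowerSeries.constantCoeff G₀) =
      (p : ℚ_[p]) ^ m * ((PowerSeries.constantCoeff g : ℤ_[p]) : ℚ_[p]) := by
    have := congrArg (fun x : IwasawaAlgebra p ↦ ((PowerSeries.constantCoeff x : ℤ_[p]) : ℚ_[p])) hh
    simp only [map_mul, PowerSeries.constantCoeff_C, PadicInt.coe_mul, PadicInt.coe_pow,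
      PadicInt.coe_natCast] at this
    rw [hG0] at this
    exact this
  -- trivial case `g(0) = 0`
  by_cases hg0 : ((PowerSeries.constantCoeff g : ℤ_[p]) : ℚ_[p]) = 0
  · exact ⟨0, by rw [hg0, PadicInt.coe_zero, zero_mul]⟩
  -- main case: everybody is nonzero
  have hg : g ≠ 0 := by
    intro e; apply hg0; rw [e, map_zero, PadicInt.coe_zero]
  have hG₀0 : PowerSeries.constantCoeff G₀ ≠ 0 := by
    intro e
    rw [e, mul_zero, mul_zero] at h0
    exact (mul_ne_zero (pow_ne_zero _ hpQ) hg0) h0.symm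
  have hh0 : ((PowerSeries.constantCoeff h : ℤ_[p]) : ℚ_[p]) ≠ 0 := by
    intro e
    rw [e, zero_mul] at h0
    exact (mul_ne_zero (pow_ne_zero _ hpQ) hg0) h0.symm
  have hhne : h ≠ 0 := by
    intro e; apply hh0; rw [e, map_zero, PadicInt.coe_zero]
  have hGne : G ≠ 0 := by
    intro e
    rw [e, mul_zero] at hh
    exact (mul_ne_zero (C_pow_ne_zero m) hg) hh.symm
  -- μ bookkeeping: `μ(h) + μ(G) = m + μ(g)`, `μ(G) ≤ n`, `μ(h) ≤ v(h(0))`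
  have hμ : mu h + mu G = m + mu g := by
    have h1 : mu (h * G) = mu h + mu G := mu_mul hhne hGne
    have h2 : mu (PowerSeries.C ((p : ℤ_[p]) ^ m) * g) = m + mu g := by
      have hfac : PowerSeries.C ((p : ℤ_[p]) ^ m) * g =
          PowerSeries.C ((p : ℤ_[p]) ^ (m + mu g)) * pfree g := by
        conv_lhs => rw [eq_C_pow_mu_mul_pfree g]
        rw [pow_add, map_mul, mul_assoc]
      exact (mu_eq_and_pfree_eq (red_pfree_ne_zero hg) hfac).1
    rw [← h1, hh, h2]
  have hμG : mu G ≤ n := mu_le_of_iota_eq_C_pow_mul_of_one_le_norm_coeff hGne hιG hunit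
  have hμh : (mu h : ℤ) ≤ ((PowerSeries.constantCoeff h : ℤ_[p]) : ℚ_[p]).valuation :=
    (TameBranchExtraZeros.mu_le_valuation_constantCoeff hhne hh0).1
  -- valuations at `T = 0`
  have hval : ((PowerSeries.constantCoeff h : ℤ_[p]) : ℚ_[p]).valuation + n +
      (PowerSeries.constantCoeff G₀).valuation =
      m + ((PowerSeries.constantCoeff g : ℤ_[p]) : ℚ_[p]).valuation := by
    have := congrArg Padic.valuation h0
    rw [Padic.valuation_mul hh0 (mul_ne_zero (pow_ne_zero _ hpQ) hG₀0),
      Padic.valuation_mul (pow_ne_zero _ hpQ) hG₀0, Padic.valuation_mul (pow_ne_zero _ hpQ) hg0,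
      Padic.valuation_pow, Padic.valuation_pow, Padic.valuation_p, mul_one, mul_one] at this
    linarith
  have hvg : (PowerSeries.constantCoeff G₀).valuation ≤
      ((PowerSeries.constantCoeff g : ℤ_[p]) : ℚ_[p]).valuation := by
    have hμg : (0 : ℤ) ≤ mu g := Nat.cast_nonneg _
    have hμ' : (mu h : ℤ) + mu G = m + mu g := by exact_mod_cast hμ
    have hμG' : (mu G : ℤ) ≤ n := by exact_mod_cast hμG
    linarith
  -- the quotient is a `p`-adic integer
  set c : ℚ_[p] := ((PowerSeries.constantCoeff g : ℤ_[p]) : ℚ_[p]) *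
    (PowerSeries.constantCoeff G₀)⁻¹ with hc
  have hc0 : c ≠ 0 := mul_ne_zero hg0 (inv_ne_zero hG₀0)
  have hcval : 0 ≤ c.valuation := by
    rw [hc, Padic.valuation_mul hg0 (inv_ne_zero hG₀0), Padic.valuation_inv]
    linarith
  refine ⟨⟨c, (Padic.norm_le_one_iff_val_nonneg c).mpr hcval⟩, ?_⟩
  change _ = c * _
  rw [hc, inv_mul_cancel_right₀ hG₀0]

/-- **The Λ-lemma with a UNIT coefficient** (the shape of the route's H7 certificates: some coefficient
of `G₀` of norm exactly `1`). [cite: Washington1997, §7.1] -/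
theorem exists_padicInt_constantCoeff_eq_mul_of_C_pow_mul_mem_span {g G : IwasawaAlgebra p} {m n : ℕ}
    {G₀ : PowerSeries ℚ_[p]} (hmem : PowerSeries.C ((p : ℤ_[p]) ^ m) * g ∈ Ideal.span {G})
    (hιG : iwasawaToPowerSeries p G = PowerSeries.C ((p : ℚ_[p]) ^ n) * G₀)
    (hunit : ∃ k : ℕ, ‖PowerSeries.coeff k G₀‖ = 1) :
    ∃ c : ℤ_[p], ((PowerSeries.constantCoeff g : ℤ_[p]) : ℚ_[p]) =
      (c : ℚ_[p]) * PowerSeries.constantCoeff G₀ :=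
  exists_padicInt_constantCoeff_eq_mul_of_C_pow_mul_mem_span_of_one_le hmem hιG
    (hunit.imp fun _ hk ↦ hk.symm.le)

/-- **`MuInequalityCore p` of the route's Sketch v2, literally** (u3-idea-iw, `Sketch.lean`
`def MuInequalityCore`): for `g h G ∈ ℤ_p⟦T⟧`, `G₀ ∈ ℚ_p⟦T⟧`, `m n` with `p^m·g = h·G`,
`ι G = p^n·G₀` and one coefficient of `G₀` of norm `≥ 1`: `‖g(0)‖ ≤ ‖G₀(0)‖`. (As the route notes,
the statement is false without the bounded denominators that `ι G = p^n G₀` forces: `h = p − T`,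
`g = 1`.) [cite: Washington1997, §7.1] -/
theorem norm_coeff_zero_le_of_C_pow_mul_eq_mul (g h G : IwasawaAlgebra p) (G₀ : PowerSeries ℚ_[p])
    (m n : ℕ) (hfac : PowerSeries.C ((p : ℤ_[p]) ^ m) * g = h * G)
    (hιG : iwasawaToPowerSeries p G = PowerSeries.C ((p : ℚ_[p]) ^ n) * G₀)
    (hunit : ∃ k : ℕ, 1 ≤ ‖PowerSeries.coeff k G₀‖) :
    ‖((PowerSeries.coeff 0 g : ℤ_[p]) : ℚ_[p])‖ ≤ ‖PowerSeries.coeff 0 G₀‖ := by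
  have hmem : PowerSeries.C ((p : ℤ_[p]) ^ m) * g ∈ Ideal.span {G} :=
    Ideal.mem_span_singleton'.mpr ⟨h, hfac.symm⟩
  obtain ⟨c, hc⟩ := exists_padicInt_constantCoeff_eq_mul_of_C_pow_mul_mem_span_of_one_le hmem hιG hunit
  rw [PowerSeries.coeff_zero_eq_constantCoeff_apply, PowerSeries.coeff_zero_eq_constantCoeff_apply, hc,
    norm_mul]
  exact mul_le_of_le_one_left (norm_nonneg _) (PadicInt.norm_le_one c)

end LambdaAlgebra

/-! ### §2 H★ + H7 ⟹ the INTEGRAL `T = 0` branch input, hence A0 — no Kato, no image hypothesis -/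

section Consequences

variable {W : WeierstrassCurve ℚ} [W.IsElliptic] [W.IsGloballyMinimal] {p : ℕ} [hp : Fact p.Prime]

omit [W.IsElliptic] [W.IsGloballyMinimal] in
/-- **H★ + H7 ⟹ `ChiBranchLowerLeadingTermOddAt W p` (`p ≡ 3 (mod 4)`, `p = 3` included), KATO-FREE
and IMAGE-FREE.** For every semistable twist datum (`V` good ordinary or multiplicative at `p`,
`C • V^{(−p)} = W`, newform `f`, minus period ratio `ϖ`): the one-sided rational containments
`ChiBranchRatLowerDvdOddAt W p` (good ordinary `V`) / `ChiBranchRatLowerDvdMultOddAt W p`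
(multiplicative `V`) and ONE unit coefficient of `ϖ·L_p⁻` give, for every `g ∈ char_Λ X(W/ℚ_∞)`,
`g(0) = h · ϖ · ∑(a/p)[a/p]⁻_f` with `h ∈ ℤ_p` — by §1 and the printed constant terms
`L_p⁻(f, α)(0) = α⁻¹·∑(a/p)[a/p]⁻_f` (MTT §I.13–I.14; `α = unitRoot V p` a unit, resp. `a_p = ±1`).
[cite: MazurTateTeitelbaum1986Invent, §I.13–I.14] [cite: Washington1997, §7.1] -/
theorem chiBranchLowerLeadingTermOddAt_of_ratLowerDvd_of_unitCoeff
    (hEisG : ChiBranchRatLowerDvdOddAt W p) (hEisM : ChiBranchRatLowerDvdMultOddAt W p)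
    (hcertG : ∀ (V : WeierstrassCurve ℚ) [V.IsElliptic] [V.IsGloballyMinimal] (C : VariableChange ℚ),
      GoodOrd V p → C • V.quadraticTwist (-(p : ℚ)) = W →
      ∀ {N : ℕ} [NeZero N] (f : CuspForm (Gamma0 N) 2), IsNewformOf V f →
      ∀ ϖ : ℚ, (ϖ : ℝ) * V.imaginaryPeriodRat = minusPeriod f →
      ∃ n : ℕ, ‖PowerSeries.coeff n
        (PowerSeries.C (ϖ : ℚ_[p]) * padicLFunctionMinusBranch f (unitRoot V p : ℚ_[p]) (p / 2))‖ = 1)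
    (hcertM : MultOddBranchUnitCoeffCert W p) :
    ChiBranchLowerLeadingTermOddAt W p := by
  intro V _ _ κ γ N _ f hp4 hCW hVred hκ hγ hγ' hf D ϖ hϖ g hg
  have hp2 : p ≠ 2 := by omega
  obtain ⟨C, hC⟩ := hCW
  rcases hVred with hV | hV
  · -- good ordinary twist
    obtain ⟨G, m, n, hmem, hιG⟩ := hEisG V hp4 ⟨C, hC⟩ hV hκ hγ hγ' hf D ϖ hϖ g hg
    obtain ⟨c, hc⟩ :=
      exists_padicInt_constantCoeff_eq_mul_of_C_pow_mul_mem_span hmem hιG (hcertG V C hV hC f hf ϖ hϖ)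
    have hord : IsOrdinaryAt V p := (isOrdinaryAt_iff V p).mpr ⟨hV.1, hV.2⟩
    obtain ⟨-, hunit⟩ := unitRoot_spec_holds V p hord
    obtain ⟨ua, hua⟩ := hunit
    rw [map_mul, PowerSeries.constantCoeff_C, constantCoeff_padicLFunctionMinusBranch_half p hp2 V hord hf,
      ← hua] at hc
    refine ⟨c * ((ua⁻¹ : ℤ_[p]ˣ) : ℤ_[p]), ?_⟩
    rw [hc, PadicInt.coe_mul, coe_units_inv_eq_inv]
    ring
  · -- multiplicative twist: `a_p = ±1`
    have hap : ∃ ap : ℤ, cuspCoeff f p = ap ∧ (ap = 1 ∨ ap = -1) := by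
      by_cases hs : V.HasSplitMultiplicativeReductionAtPrime p
      · exact ⟨1, by exact_mod_cast (hf.cuspCoeff_eq_one_and_sq_of_split hs).1, Or.inl rfl⟩
      · exact ⟨-1, by exact_mod_cast (hf.cuspCoeff_eq_neg_one_and_dvd_of_nonsplit hV hs).1, Or.inr rfl⟩
    obtain ⟨ap, hap, hap1⟩ := hap
    have hap0 : (ap : ℚ_[p]) ≠ 0 := by rcases hap1 with rfl | rfl <;> norm_num
    have hapinv : (ap : ℚ_[p])⁻¹ = (ap : ℚ_[p]) := by rcases hap1 with rfl | rfl <;> norm_num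
    have hpN : p ∣ N := by
      by_cases hs : V.HasSplitMultiplicativeReductionAtPrime p
      · exact hf.dvd_level_of_split hs
      · exact (hf.cuspCoeff_eq_neg_one_and_dvd_of_nonsplit hV hs).2
    obtain ⟨G, m, n, hmem, hιG⟩ := hEisM V hp4 ⟨C, hC⟩ hV hκ hγ hγ' hf ap hap D ϖ hϖ g hg
    obtain ⟨c, hc⟩ := exists_padicInt_constantCoeff_eq_mul_of_C_pow_mul_mem_span hmem hιG
      (hcertM V C hV hC f hf ap hap ϖ hϖ)
    rw [map_mul, PowerSeries.constantCoeff_C,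
      constantCoeff_padicLFunctionMinusBranchMult_half p hp2 hf.1 hf.coeffField_eq_bot hpN hap hap0,
      hapinv] at hc
    refine ⟨c * ap, ?_⟩
    rw [hc]
    push_cast
    ring

/-- **H★ + H7 ⟹ A0 = `CycLowerLeadingTermAt W 3` on the WHOLE potentially-ordinary additive locus at
`3`, image-free and Kato-free** — composing §2's branch input with the tree's `T = 0` dictionaries
(Birch–Pal transport to the Néron period; Pal 2012 Thm. 3.2 `d < 0` PROVED; modularity `hmod`,
parametrisation data `hmodD`). With the sibling file `IwasawaDescentAtThree` this gives
`MissingLowerBoundAt W 3` for every rank-`0` row of the locus (off CM / anomalous (G)-rows) with NO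
surjectivity hypothesis — the conditional uniform theorem in the image-free shape of `N10.LowerHalf`
at `3` (ROUTE-IW §8 P3). [cite: Pal2012, Thm. 3.2] [cite: MazurTateTeitelbaum1986Invent, §I.13–I.14]
[cite: Washington1997, §7.1] -/
theorem cycLowerLeadingTerm_three_of_omegaBranchEisenstein_of_unitCoeff [Fact (Nat.Prime 3)]
    (hmod : hasEntireLFunction_rat) (hmodD : nonempty_modularParametrizationData)
    (hadd : Addv W 3) (hord : Additive.PotMult W 3 ∨ TypeGOrd W 3)
    (hEisG : ChiBranchRatLowerDvdOddAt W 3) (hEisM : ChiBranchRatLowerDvdMultOddAt W 3)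
    (hcertG : ∀ (V : WeierstrassCurve ℚ) [V.IsElliptic] [V.IsGloballyMinimal] (C : VariableChange ℚ),
      GoodOrd V 3 → C • V.quadraticTwist (-(3 : ℚ)) = W →
      ∀ {N : ℕ} [NeZero N] (f : CuspForm (Gamma0 N) 2), IsNewformOf V f →
      ∀ ϖ : ℚ, (ϖ : ℝ) * V.imaginaryPeriodRat = minusPeriod f →
      ∃ n : ℕ, ‖PowerSeries.coeff n
        (PowerSeries.C (ϖ : ℚ_[3]) * padicLFunctionMinusBranch f (unitRoot V 3 : ℚ_[3]) (3 / 2))‖ = 1)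
    (hcertM : MultOddBranchUnitCoeffCert W 3) : CycLowerLeadingTermAt W 3 := by
  have hLow : ChiBranchLowerLeadingTermOddAt W 3 :=
    chiBranchLowerLeadingTermOddAt_of_ratLowerDvd_of_unitCoeff hEisG hEisM
      (by exact_mod_cast hcertG) hcertM
  rcases hord with hM | hG
  · by_cases hirr : Irr W 3
    · exact (AdditivePotMult.ClassX4M.cycLowerLeadingTermAt_iff_chiBranchLowerOdd hmod hmodD
        ⟨⟨by decide, hadd, hirr⟩, hadd, hM⟩ (by decide)).mpr hLow
    · exact (AdditivePotMult.ClassX3M.cycLowerLeadingTermAt_iff_chiBranchLowerOdd hmod hmodD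
        ⟨⟨hirr, hadd⟩, ⟨hadd, hM⟩, by decide⟩ (by decide)).mpr hLow
  · exact (cycLowerLeadingTermAt_iff_chiBranchLowerOdd_of_typeGOrd_of_semistabilityIndex_eq_two W 3
      hmod hmodD (by decide) hadd hG (semistabilityIndex_eq_two_of_typeG_three W hG.typeG hadd)).mpr hLow

end Consequences

/-! ### §3 Two Kato-free closures from H★ + H7: the anomalous (G)-rows (slack `2`) and the
reducible-image rows (`BSD(E,3)` with Wuthrich's Thm. 16 as the upper half) -/

section Closures

variable {W : WeierstrassCurve ℚ} [W.IsElliptic] [W.IsGloballyMinimal]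

/-- **ANOMALOUS (G)-rows at `3`, Kato-free**: on a (G)-ordinary additive row at `3` of analytic rank
`0`, non-CM, WITHOUT the non-anomalous proviso, H★ + H7 give `#Ш_an = q` with
`ord₃ q ≤ ord₃ #Ш(E) + 2` — the residue R3-IW-2 made quantitative (Delbourgo 2002 Theorem (B)'s
`ℓ₃(E) ∣ 9`, tree `TypeGOrd.padicValRat_shaAn_le_add_two_three_of_cycLower`).
[cite: Delbourgo2002, Theorem (A), (B) (p. 40), ℓ_p(E) (p. 39)] [cite: Washington1997, §7.1] -/
theorem padicValRat_shaAn_le_add_two_three_of_omegaBranchEisenstein_of_unitCoeff [Fact (Nat.Prime 3)]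
    (hDel3 : Delbourgo2002.mainTheorem_three)
    (hGZK : rank_eq_analyticRank_of_analyticRank_le_one) (hmod : hasEntireLFunction_rat)
    (hmodD : nonempty_modularParametrizationData)
    (hG : TypeGOrd W 3) (hadd : Addv W 3) (hcm : ¬ W.HasCM) (hr : W.analyticRank = 0)
    (hEisG : ChiBranchRatLowerDvdOddAt W 3) (hEisM : ChiBranchRatLowerDvdMultOddAt W 3)
    (hcertG : ∀ (V : WeierstrassCurve ℚ) [V.IsElliptic] [V.IsGloballyMinimal] (C : VariableChange ℚ),
      GoodOrd V 3 → C • V.quadraticTwist (-(3 : ℚ)) = W →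
      ∀ {N : ℕ} [NeZero N] (f : CuspForm (Gamma0 N) 2), IsNewformOf V f →
      ∀ ϖ : ℚ, (ϖ : ℝ) * V.imaginaryPeriodRat = minusPeriod f →
      ∃ n : ℕ, ‖PowerSeries.coeff n
        (PowerSeries.C (ϖ : ℚ_[3]) * padicLFunctionMinusBranch f (unitRoot V 3 : ℚ_[3]) (3 / 2))‖ = 1)
    (hcertM : MultOddBranchUnitCoeffCert W 3) :
    ∃ q : ℚ, shaAn W = (q : ℂ) ∧ padicValRat 3 q ≤ padicValNat 3 W.shaOrder + 2 :=
  hG.padicValRat_shaAn_le_add_two_three_of_cycLower hDel3 hGZK hmod hadd hcm hr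
    (cycLowerLeadingTerm_three_of_omegaBranchEisenstein_of_unitCoeff hmod hmodD hadd (Or.inr hG) hEisG
      hEisM hcertG hcertM)

/-- **REDUCIBLE-image rows (X3) at `3`, rank `0`, fully Kato-free `BSD(E,3)` from H★ + H7**: LOWER by
§2 (Λ-lemma) and the sibling's Delbourgo descent, UPPER by Wuthrich 2014 Thm. 16 on the
`ω`-component (`hW16`, no image hypothesis) — potentially multiplicative or (G)-ordinary (non-CM,
non-anomalous) rows with `E[3]` reducible. Inputs: Delbourgo 1998 Prop. 4 (`hDel`, `hDelX`), Delbourgo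
2002 at `3` (`hDel3`), GZK, modularity. [cite: Wuthrich2014, Thm. 16 (p. 397)]
[cite: Delbourgo1998, Prop. 4 (p. 144), §2.2 Lemma (ii) (p. 139)] [cite: Delbourgo2002, Theorem (A), (B) (p. 40)]
[cite: Miller2011LMS, §1 and Def. 1.1] -/
theorem bsdp_three_rankZero_of_red_of_omegaBranchEisenstein_of_unitCoeff [Fact (Nat.Prime 3)]
    (hDel : Delbourgo1998.prop4_rankZero_pow_dvd_constantCoeff)
    (hDelX : Delbourgo1998.prop4_rankZero_constantCoeff_eq_unit_mul_of_potMult)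
    (hDel3 : Delbourgo2002.mainTheorem_three)
    (hW16 : Wuthrich2014.thm16_minusEigenCharIdeal_dvd_cyclotomicThree)
    (hGZK : rank_eq_analyticRank_of_analyticRank_le_one) (hmod : hasEntireLFunction_rat)
    (hmodD : nonempty_modularParametrizationData)
    (hred : Red W 3) (hadd : Addv W 3) (hord : Additive.PotMult W 3 ∨ TypeGOrd W 3)
    (hr : W.analyticRank = 0) (hcm : TypeGOrd W 3 → ¬ W.HasCM)
    (hna : TypeGOrd W 3 → Delbourgo2002.ReductionNonAnomalous W 3)
    (hEisG : ChiBranchRatLowerDvdOddAt W 3) (hEisM : ChiBranchRatLowerDvdMultOddAt W 3)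
    (hcertG : ∀ (V : WeierstrassCurve ℚ) [V.IsElliptic] [V.IsGloballyMinimal] (C : VariableChange ℚ),
      GoodOrd V 3 → C • V.quadraticTwist (-(3 : ℚ)) = W →
      ∀ {N : ℕ} [NeZero N] (f : CuspForm (Gamma0 N) 2), IsNewformOf V f →
      ∀ ϖ : ℚ, (ϖ : ℝ) * V.imaginaryPeriodRat = minusPeriod f →
      ∃ n : ℕ, ‖PowerSeries.coeff n
        (PowerSeries.C (ϖ : ℚ_[3]) * padicLFunctionMinusBranch f (unitRoot V 3 : ℚ_[3]) (3 / 2))‖ = 1)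
    (hcertM : MultOddBranchUnitCoeffCert W 3) : BSDp W 3 := by
  have hA0 : CycLowerLeadingTermAt W 3 :=
    cycLowerLeadingTerm_three_of_omegaBranchEisenstein_of_unitCoeff hmod hmodD hadd hord hEisG hEisM
      hcertG hcertM
  rcases hord with hM | hG
  · exact AdditivePotMult.ClassX3M.bsdp_three_rankZero_of_lower hDel hGZK hmod hmodD hW16
      ⟨⟨hred, hadd⟩, ⟨hadd, hM⟩, by decide⟩ hr
      (missingLowerBoundAt_rankZero_of_potMult_of_cycLeadingTermDvd W 3 hDelX hGZK hmod (by decide)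
        hadd hM hr ((cycLeadingTermDvdAt_iff_cycLowerLeadingTermAt W 3).mpr hA0))
  · exact ClassX3Gord.bsdp_three_rankZero_of_cycLower_of_nonAnomalous hDel3 hW16 hDel hGZK hmod hmodD
      ⟨⟨hred, hadd⟩, hG⟩ (hcm hG) hr (hna hG) hA0

end Closures

end Summit.BirchSwinnertonDyer.Uniform.U3

end
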